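import Literature.NumberTheory.CubicFields.DavenportHeilbronnMaximality
import Literature.NumberTheory.CubicFields.DeloneFaddeevIndexForm
import HarnessLib

/-!
# The content of a cubic ring equals the content of its form (BTT §2.2, from [BST])

Topic `Literature/NumberTheory/CubicFields`; built on `BinaryCubicForms.lean` (`BinaryCubic.content`,
the gcd of the coefficients), `DavenportHeilbronnMaximality.lean` (`IsMultiple`, the overring
`ofMultiple : R(n • g) ↪ R(g)` with image `ℤ + n R(g)`) and `DeloneFaddeevIndexForm.lean`
(`GL2ZEquiv.of_ringEquiv`).

Bhargava–Taniguchi–Thorne 2023, §2.2: "The content `ct(R)` of a cubic ring `R` is the largest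
integer `n` such that `R = ℤ + nR'` for some cubic ring `R'`; the content of a binary cubic form is
the gcd of its coefficients. As explained in [BST], a cubic form `f` and its corresponding cubic ring
`R` have the same content." Every cubic ring `R'` is an `R(g)` (Levi–Delone–Faddeev) and
`ℤ + n R(g) ≅ R(n • g)` (`range_ofMultiple`), so "`R(f) = ℤ + nR'` for some cubic ring `R'`" reads
`R(f) ≅ R(n • g)` for some form `g`:

* `RingOfForm.IsContentMultiple n f := ∃ g, Nonempty (R(f) ≃+* R(n • g))`;
* `RingOfForm.range_ofMultiple` — `ℤ + n R(g)` is the image of `R(n • g) ↪ R(g)`;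
* **`RingOfForm.isContentMultiple_iff_isMultiple`** — `R(f) ≅ ℤ + nR'` iff `n` divides every
  coefficient of `f` (⇐ `ofMultiple`; ⇒ `GL₂(ℤ)`-equivalence with `n • g` and linearity of the action);
* `BinaryCubic.dvd_content_iff` and **`RingOfForm.isContentMultiple_iff_dvd_content`** — hence the
  `n` with `R(f) ≅ ℤ + nR'` are exactly the divisors of `ct(f)`: **`ct(R(f)) = ct(f)`**
  (`isContentMultiple_content`, `dvd_content_of_isContentMultiple`).

## References

* M. Bhargava, T. Taniguchi, F. Thorne, *Improved error estimates for the Davenport–Heilbronn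
  theorems*, Math. Ann. 389 (2024) = arXiv:2107.12819, §2.2 [BhargavaTaniguchiThorne2023].
* M. Bhargava, A. Shankar, J. Tsimerman, *On the Davenport–Heilbronn theorems and second order
  terms*, Invent. Math. 193 (2013), §3 [BhargavaShankarTsimerman2012].
-/

namespace Literature.NumberTheory.CubicFields

namespace BinaryCubic

/-- `n ∣ ct(f)` iff `n` divides every coefficient, i.e. iff `f` is a multiple of `n`. [folklore] -/
theorem dvd_content_iff {n : ℤ} {f : BinaryCubic ℤ} : n ∣ (f.content : ℤ) ↔ f.IsMultiple n := by
  constructor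
  · intro h
    obtain ⟨ha, hb, hc, hd⟩ := content_dvd f
    exact ⟨h.trans ha, h.trans hb, h.trans hc, h.trans hd⟩
  · rintro ⟨ha, hb, hc, hd⟩
    rw [content]
    exact Int.dvd_coe_gcd (Int.dvd_coe_gcd ha hb) (Int.dvd_coe_gcd hc hd)

/-- The content is a multiple-of-witness: `f` is a multiple of `ct(f)`. [folklore] -/
theorem isMultiple_content (f : BinaryCubic ℤ) : f.IsMultiple f.content :=
  dvd_content_iff.mp dvd_rfl

/-- `ct(f) = 0` iff `f = 0`. [folklore] -/
theorem content_eq_zero_iff {f : BinaryCubic ℤ} : f.content = 0 ↔ f = ⟨0, 0, 0, 0⟩ := by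
  constructor
  · intro h
    obtain ⟨ha, hb, hc, hd⟩ := content_dvd f
    rw [h, Nat.cast_zero, zero_dvd_iff] at ha hb hc hd
    exact BinaryCubic.ext ha hb hc hd
  · rintro rfl
    simp [content]

end BinaryCubic

namespace RingOfForm

open BinaryCubic

variable {f : BinaryCubic ℤ}

/-- **`ℤ + n R(g)` is the image of `R(n • g) ↪ R(g)`**: the subring of elements whose `ω`- and
`θ`-coordinates are divisible by `n`. [folklore] -/
theorem range_ofMultiple (n : ℤ) (g : BinaryCubic ℤ) :
    Set.range (ofMultiple n g) = {P : RingOfForm g | n ∣ P.y ∧ n ∣ P.z} := by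
  ext P
  constructor
  · rintro ⟨Q, rfl⟩
    exact ⟨⟨Q.y, rfl⟩, ⟨Q.z, rfl⟩⟩
  · rintro ⟨⟨y, hy⟩, ⟨z, hz⟩⟩
    exact ⟨⟨P.x, y, z⟩, by ext <;> simp [hy, hz]⟩

/-- **`R(f) = ℤ + n R'` for some cubic ring `R'`** (BTT §2.2), on the side of forms: `R(f) ≅ R(n • g)`
for some integral form `g` (every cubic ring being an `R(g)`, and `ℤ + nR(g) ≅ R(n • g)` by
`range_ofMultiple`). [cite: BhargavaTaniguchiThorne2023, §2.2 (content of a cubic ring: R = ℤ + nR')] -/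
def IsContentMultiple (n : ℤ) (f : BinaryCubic ℤ) : Prop :=
  ∃ g : BinaryCubic ℤ, Nonempty (RingOfForm f ≃+* RingOfForm (n • g))

/-- **`R(f) ≅ ℤ + nR'` iff `n` divides every coefficient of `f`.** (⇐) `f = n • g` itself;
(⇒) `R(f) ≅ R(n • g)` gives `f ∼ n • g` under `GL₂(ℤ)` (Delone–Faddeev injectivity), and the twisted
action is linear: `twist γ (n • g) = n • twist γ g`. [folklore] -/
theorem isContentMultiple_iff_isMultiple {n : ℤ} : IsContentMultiple n f ↔ f.IsMultiple n := by
  constructor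
  · rintro ⟨g, ⟨e⟩⟩
    obtain ⟨γ, -, rfl⟩ := (GL2ZEquiv.of_ringEquiv e).symm
    exact isMultiple_iff_exists_smul.mpr ⟨twist γ g, twist_smul γ n g⟩
  · intro h
    obtain ⟨g, rfl⟩ := isMultiple_iff_exists_smul.mp h
    exact ⟨g, ⟨RingEquiv.refl _⟩⟩

/-- Hence **the `n` with `R(f) ≅ ℤ + nR'` are exactly the divisors of `ct(f)`**. [folklore] -/
theorem isContentMultiple_iff_dvd_content {n : ℤ} : IsContentMultiple n f ↔ n ∣ (f.content : ℤ) := by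
  rw [isContentMultiple_iff_isMultiple, dvd_content_iff]

/-- **`ct(R(f)) = ct(f)`, existence half**: `R(f) ≅ ℤ + ct(f) · R'`. [cite: BhargavaTaniguchiThorne2023, §2.2 (a cubic form and its cubic ring have the same content)] -/
theorem isContentMultiple_content (f : BinaryCubic ℤ) : IsContentMultiple (f.content : ℤ) f :=
  isContentMultiple_iff_dvd_content.mpr dvd_rfl

/-- **`ct(R(f)) = ct(f)`, maximality half**: if `R(f) ≅ ℤ + nR'` then `n ∣ ct(f)`; so for `f ≠ 0`
the content `ct(f)` is the largest such `n`. [cite: BhargavaTaniguchiThorne2023, §2.2 (a cubic form and its cubic ring have the same content)] -/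
theorem dvd_content_of_isContentMultiple {n : ℤ} (h : IsContentMultiple n f) : n ∣ (f.content : ℤ) :=
  isContentMultiple_iff_dvd_content.mp h

/-- … numerically: for `f ≠ 0`, every `n` with `R(f) ≅ ℤ + nR'` satisfies `n ≤ ct(f)`. [folklore] -/
theorem le_content_of_isContentMultiple (hf : f ≠ ⟨0, 0, 0, 0⟩) {n : ℤ} (h : IsContentMultiple n f) : n ≤ f.content := by
  have h0 : (f.content : ℤ) ≠ 0 := by
    exact_mod_cast fun h' => hf (BinaryCubic.content_eq_zero_iff.mp h')
  have hpos : 0 < (f.content : ℤ) := lt_of_le_of_ne (Int.natCast_nonneg _) (Ne.symm h0)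
  exact Int.le_of_dvd hpos (dvd_content_of_isContentMultiple h)

/-- `ct` is an invariant of the ring: isomorphic cubic rings have forms of the same content. [folklore] -/
theorem content_eq_of_ringEquiv {g : BinaryCubic ℤ} (e : RingOfForm f ≃+* RingOfForm g) : f.content = g.content := by
  apply Nat.dvd_antisymm <;> rw [← Int.natCast_dvd_natCast, ← isContentMultiple_iff_dvd_content]
  · obtain ⟨k, ⟨e'⟩⟩ := isContentMultiple_content f
    exact ⟨k, ⟨e.symm.trans e'⟩⟩
  · obtain ⟨k, ⟨e'⟩⟩ := isContentMultiple_content g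
    exact ⟨k, ⟨e.trans e'⟩⟩

end RingOfForm

end Literature.NumberTheory.CubicFields
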